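import Literature.NumberTheory.Sieve.FordMaynardFramework
import Literature.Analysis.Convolution.OneSidedConvolutionPowers
import HarnessLib

/-!
# Slice integrals of product functions are convolution powers

Companion of `FordMaynardFramework.lean` (everything PROVED): the calculus of the slice
integrals `sliceIntegral d w G = ∫_{u ∈ (0,∞)^d, |u| = w} G(u) du` (projection measure):
congruence on the slice, scalars, additivity, the integrand `sliceIntegrand` and its
measurability/integrability (bounded with bounded support), **peeling off the first coordinate**
(`sliceIntegral_succ_succ`, via the measure-preserving `piFinSuccAbove` and Fubini), and

  `sliceIntegral_prod_eq_cpow`:  `∫_{|u| = w, u ∈ (0,∞)^{d+1}} φ(u₁)⋯φ(u_{d+1}) du = φ^{⋆(d+1)}(w)`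

(`cpow` of `Literature/Analysis/Convolution/OneSidedConvolutionPowers.lean`), which turns the
Type-I identity (TypeI-f) for product-form functions into one-dimensional convolution identities
(Ford–Maynard, arXiv:2407.14368, Lemma 9.2/9.5, here in the 1-D convolution model).
-/

noncomputable section

namespace Literature.NumberTheory.Sieve.FordMaynard

open MeasureTheory Set Finset Literature.Analysis.Convolution

/-! ### Slice integrals: congruence, scalars, and the peel-off of the first coordinate -/

section Slice

/-- Two integrands that agree on the open slice `{u_i > 0, ∑ u_i = w}` have the same slice
integral. [folklore] -/
theorem sliceIntegral_congr {d : ℕ} {w : ℝ} {G G' : (Fin d → ℝ) → ℝ}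
    (h : ∀ v : Fin d → ℝ, (∀ i, 0 < v i) → ∑ i, v i = w → G v = G' v) :
    sliceIntegral d w G = sliceIntegral d w G' := by
  cases d with
  | zero => rfl
  | succ d =>
    simp only [sliceIntegral]
    refine integral_congr_ae (Filter.Eventually.of_forall fun u => ?_)
    show (if _ then _ else _) = (if _ then _ else _)
    split_ifs with hu
    · refine h _ (fun i => ?_) ?_
      · refine Fin.lastCases ?_ (fun j => ?_) i
        · simp only [Fin.snoc_last]; linarith [hu.2]
        · simp only [Fin.snoc_castSucc]; exact hu.1 j
      · rw [Fin.sum_univ_castSucc]; simp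
    · rfl

/-- Scalars pull out of slice integrals. [folklore] -/
theorem sliceIntegral_const_mul {d : ℕ} (w c : ℝ) (G : (Fin d → ℝ) → ℝ) :
    sliceIntegral d w (fun u => c * G u) = c * sliceIntegral d w G := by
  cases d with
  | zero => simp [sliceIntegral]
  | succ d =>
    simp only [sliceIntegral]
    rw [← integral_const_mul]
    refine integral_congr_ae (Filter.Eventually.of_forall fun u => ?_)
    show (if _ then _ else _) = c * (if _ then _ else _)
    split_ifs <;> simp

/-- The symm of `piFinSuccAbove` at `0` is `Fin.cons`. [folklore] -/
theorem piFinSuccAbove_zero_symm_apply (d : ℕ) (p : ℝ × (Fin d → ℝ)) :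
    (MeasurableEquiv.piFinSuccAbove (fun _ => ℝ) 0).symm p = Fin.cons p.1 p.2 := by
  obtain ⟨t, v⟩ := p
  simp [MeasurableEquiv.piFinSuccAbove, Fin.insertNthEquiv, Fin.insertNth_zero']

/-- The slice integrand in dimension `d + 1` (integration variable `u ∈ ℝ^{d}`... here for the
slice of `ℝ^{d+1}` parametrised by `u ∈ ℝ^d`). [folklore] -/
def sliceIntegrand (d : ℕ) (w : ℝ) (G : (Fin (d + 1) → ℝ) → ℝ) (u : Fin d → ℝ) : ℝ :=
  if (∀ i, 0 < u i) ∧ ∑ i, u i < w then G (Fin.snoc u (w - ∑ i, u i)) else 0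

/-- The slice integral in dimension `d + 1` is the integral of `sliceIntegrand d`. [folklore] -/
theorem sliceIntegral_succ_eq (d : ℕ) (w : ℝ) (G : (Fin (d + 1) → ℝ) → ℝ) :
    sliceIntegral (d + 1) w G = ∫ u, sliceIntegrand d w G u := rfl

/-- The slice integrand vanishes identically when `w ≤ 0`. [folklore] -/
theorem sliceIntegrand_eq_zero_of_nonpos (d : ℕ) {w : ℝ} (hw : w ≤ 0) (G : (Fin (d + 1) → ℝ) → ℝ)
    (u : Fin d → ℝ) : sliceIntegrand d w G u = 0 := by
  unfold sliceIntegrand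
  rw [if_neg]
  rintro ⟨h1, h2⟩
  have : 0 ≤ ∑ i, u i := Finset.sum_nonneg fun i _ => (h1 i).le
  linarith


/-- Measurability of the slice integrand. [folklore] -/
theorem measurable_sliceIntegrand (d : ℕ) (w : ℝ) {G : (Fin (d + 1) → ℝ) → ℝ}
    (hG : Measurable G) : Measurable (sliceIntegrand d w G) := by
  unfold sliceIntegrand
  have hset : MeasurableSet {u : Fin d → ℝ | (∀ i, 0 < u i) ∧ ∑ i, u i < w} := by
    have h1 : {u : Fin d → ℝ | (∀ i, 0 < u i) ∧ ∑ i, u i < w} =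
        (⋂ i, {u : Fin d → ℝ | 0 < u i}) ∩ {u | ∑ i, u i < w} := by
      ext u; simp
    rw [h1]
    exact (MeasurableSet.iInter fun i => measurableSet_lt measurable_const (measurable_pi_apply i)).inter
      (measurableSet_lt (Finset.measurable_sum _ fun i _ => measurable_pi_apply i) measurable_const)
  have hsnoc : Measurable fun u : Fin d → ℝ => (Fin.snoc u (w - ∑ i, u i) : Fin (d + 1) → ℝ) := by
    refine measurable_pi_iff.2 fun i => ?_
    refine Fin.lastCases ?_ (fun j => ?_) i
    · simp only [Fin.snoc_last]
      exact measurable_const.sub (Finset.measurable_sum _ fun i _ => measurable_pi_apply i)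
    · simp only [Fin.snoc_castSucc]; exact measurable_pi_apply j
  exact Measurable.ite hset (hG.comp hsnoc) measurable_const

/-- A bound for the slice integrand from a bound for `G` on the slice. [folklore] -/
theorem abs_sliceIntegrand_le (d : ℕ) (w : ℝ) {G : (Fin (d + 1) → ℝ) → ℝ} {C : ℝ} (hC : 0 ≤ C)
    (hG : ∀ v : Fin (d + 1) → ℝ, (∀ i, 0 < v i) → ∑ i, v i = w → |G v| ≤ C) (u : Fin d → ℝ) :
    |sliceIntegrand d w G u| ≤ C := by
  unfold sliceIntegrand
  split_ifs with hu
  · refine hG _ (fun i => ?_) ?_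
    · refine Fin.lastCases ?_ (fun j => ?_) i
      · simp only [Fin.snoc_last]; linarith [hu.2]
      · simp only [Fin.snoc_castSucc]; exact hu.1 j
    · rw [Fin.sum_univ_castSucc]; simp
  · rw [abs_zero]; exact hC

/-- The slice integrand vanishes outside the box `(0, w)^d`. [folklore] -/
theorem sliceIntegrand_eq_zero (d : ℕ) (w : ℝ) (G : (Fin (d + 1) → ℝ) → ℝ) {u : Fin d → ℝ}
    (hu : ¬ (∀ i, 0 < u i ∧ u i < w)) : sliceIntegrand d w G u = 0 := by
  unfold sliceIntegrand
  rw [if_neg]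
  rintro ⟨h1, h2⟩
  refine hu fun i => ⟨h1 i, ?_⟩
  have : u i ≤ ∑ j, u j :=
    Finset.single_le_sum (f := u) (fun j _ => (h1 j).le) (Finset.mem_univ i)
  linarith

/-- The slice integrand is integrable (bounded with bounded support). [folklore] -/
theorem integrable_sliceIntegrand (d : ℕ) (w : ℝ) {G : (Fin (d + 1) → ℝ) → ℝ}
    (hG : Measurable G) {C : ℝ} (hC : 0 ≤ C)
    (hGb : ∀ v : Fin (d + 1) → ℝ, (∀ i, 0 < v i) → ∑ i, v i = w → |G v| ≤ C) :
    Integrable (sliceIntegrand d w G) := by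
  -- supported in the box `Icc 0 w ^ d`, of finite measure, and bounded by `C`
  have hsupp : Function.support (sliceIntegrand d w G) ⊆ Set.pi Set.univ fun _ => Set.Icc 0 w := by
    intro u hu
    simp only [Function.mem_support] at hu
    by_contra hbox
    refine hu (sliceIntegrand_eq_zero d w G fun hall => hbox ?_)
    simp only [Set.mem_pi, Set.mem_univ, Set.mem_Icc, forall_true_left]
    exact fun i => ⟨(hall i).1.le, (hall i).2.le⟩
  rw [← integrableOn_iff_integrable_of_support_subset hsupp]
  have hfin : volume (Set.pi Set.univ fun _ : Fin d => Set.Icc (0 : ℝ) w) < ⊤ := by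
    rw [Set.pi_univ_Icc]
    exact isCompact_Icc.measure_lt_top
  refine Measure.integrableOn_of_bounded (M := C) hfin.ne
    (measurable_sliceIntegrand d w hG).aestronglyMeasurable ?_
  exact Filter.Eventually.of_forall fun u => by
    rw [Real.norm_eq_abs]; exact abs_sliceIntegrand_le d w hC hGb u

/-- The slice integrand at `Fin.cons t v` is the slice integrand in one dimension less of
`G (Fin.cons t ·)` at `w − t` (for `t > 0`), and `0` for `t ≤ 0`. [folklore] -/
theorem sliceIntegrand_cons (d : ℕ) (w : ℝ) (G : (Fin (d + 2) → ℝ) → ℝ) (t : ℝ) (v : Fin d → ℝ) :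
    sliceIntegrand (d + 1) w G (Fin.cons t v) =
      if 0 < t then sliceIntegrand d (w - t) (fun v' => G (Fin.cons t v')) v else 0 := by
  unfold sliceIntegrand
  simp only [Fin.forall_fin_succ, Fin.cons_zero, Fin.cons_succ, Fin.sum_univ_succ]
  by_cases ht : 0 < t
  · simp only [ht, true_and, if_true]
    by_cases hv : (∀ i, 0 < v i) ∧ ∑ i, v i < w - t
    · rw [if_pos ⟨hv.1, by linarith [hv.2]⟩, if_pos hv, ← Fin.cons_snoc_eq_snoc_cons]
      congr 2
      ring
    · rw [if_neg, if_neg hv]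
      rintro ⟨h1, h2⟩
      exact hv ⟨h1, by linarith⟩
  · simp [ht]

/-- **Peeling off the first coordinate**:
`∫_{|u|=w, u ∈ (0,∞)^{d+2}} G = ∫_{0<t<w} ∫_{|v| = w−t, v ∈ (0,∞)^{d+1}} G(t, v) dt`. [folklore] -/
theorem sliceIntegral_succ_succ (d : ℕ) (w : ℝ) {G : (Fin (d + 2) → ℝ) → ℝ} (hG : Measurable G)
    {C : ℝ} (hC : 0 ≤ C) (hGb : ∀ v : Fin (d + 2) → ℝ, (∀ i, 0 < v i) → ∑ i, v i = w → |G v| ≤ C) :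
    sliceIntegral (d + 2) w G =
      ∫ t in Set.Ioc 0 w, sliceIntegral (d + 1) (w - t) (fun v => G (Fin.cons t v)) := by
  rw [sliceIntegral_succ_eq]
  set e := MeasurableEquiv.piFinSuccAbove (fun _ : Fin (d + 1) => ℝ) 0 with he
  have hmp : MeasurePreserving e := volume_preserving_piFinSuccAbove (fun _ : Fin (d + 1) => ℝ) 0
  have hint : Integrable (sliceIntegrand (d + 1) w G) := integrable_sliceIntegrand (d + 1) w hG hC hGb
  -- change variables `u = Fin.cons t v`
  have h1 : ∫ u, sliceIntegrand (d + 1) w G u =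
      ∫ p : ℝ × (Fin d → ℝ), sliceIntegrand (d + 1) w G (Fin.cons p.1 p.2) := by
    rw [← hmp.symm.integral_comp' (f := e.symm)]
    refine integral_congr_ae (Filter.Eventually.of_forall fun p => ?_)
    show sliceIntegrand (d + 1) w G (e.symm p) = sliceIntegrand (d + 1) w G (Fin.cons p.1 p.2)
    rw [he, piFinSuccAbove_zero_symm_apply]
  rw [h1]
  have hint2 : Integrable (fun p : ℝ × (Fin d → ℝ) => sliceIntegrand (d + 1) w G (Fin.cons p.1 p.2))
      (volume.prod volume) := by
    have := hmp.symm.integrable_comp_emb e.symm.measurableEmbedding |>.2 hint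
    refine (integrable_congr (Filter.Eventually.of_forall fun p => ?_)).1 this
    show sliceIntegrand (d + 1) w G (e.symm p) = _
    rw [he, piFinSuccAbove_zero_symm_apply]
  rw [show (volume : Measure (ℝ × (Fin d → ℝ))) = volume.prod volume from rfl, integral_prod _ hint2]
  -- compute the inner integral
  rw [← integral_indicator measurableSet_Ioc]
  refine integral_congr_ae ?_
  filter_upwards [Measure.ae_ne volume w] with t htw
  simp only [sliceIntegrand_cons]
  by_cases ht : 0 < t
  · simp only [ht, if_true, Set.indicator, Set.mem_Ioc, true_and]
    by_cases htw' : t ≤ w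
    · rw [if_pos htw']; rfl
    · rw [if_neg htw']
      -- for `t > w` the inner slice is empty
      refine integral_eq_zero_of_ae (Filter.Eventually.of_forall fun v => ?_)
      have hwt : w - t ≤ 0 := by linarith [not_le.1 htw']
      exact sliceIntegrand_eq_zero_of_nonpos d hwt _ v
  · simp only [ht, if_false, integral_zero, Set.indicator, Set.mem_Ioc, false_and]


/-- **Slice integrals of products are convolution powers**: for `φ` locally bounded and `w > 0`,
`∫_{u ∈ (0,∞)^{d+1}, |u| = w} φ(u₁) ⋯ φ(u_{d+1}) = φ^{⋆(d+1)}(w)`. [folklore] -/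
theorem sliceIntegral_prod_eq_cpow {φ : ℝ → ℝ} (hφ : LocBdd φ) :
    ∀ (d : ℕ) {w : ℝ}, 0 < w → sliceIntegral (d + 1) w (fun u => ∏ i, φ (u i)) = cpow φ (d + 1) w
  | 0, w, hw => by
    rw [sliceIntegral_one, if_pos hw, cpow_one]
    simp
  | d + 1, w, hw => by
    -- bound for the integrand on the slice: all coordinates lie in `(0, w)`
    obtain ⟨C, hC0, hC⟩ := hφ.bdd_nonneg w
    have hGb : ∀ v : Fin (d + 2) → ℝ, (∀ i, 0 < v i) → ∑ i, v i = w → |∏ i, φ (v i)| ≤ C ^ (d + 2) := by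
      intro v hv hsum
      rw [Finset.abs_prod]
      calc ∏ i, |φ (v i)| ≤ ∏ _i : Fin (d + 2), C := by
            refine Finset.prod_le_prod (fun i _ => abs_nonneg _) fun i _ => hC _ ?_
            have : v i ≤ ∑ j, v j :=
              Finset.single_le_sum (f := v) (fun j _ => (hv j).le) (Finset.mem_univ i)
            rw [abs_of_pos (hv i)]; linarith
        _ = C ^ (d + 2) := by simp
    have hGm : Measurable fun u : Fin (d + 2) → ℝ => ∏ i, φ (u i) :=
      Finset.measurable_prod _ fun i _ => hφ.measurable.comp (measurable_pi_apply i)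
    rw [sliceIntegral_succ_succ d w hGm (by positivity) hGb, cpow_succ_succ, oconv]
    -- compare on the open interval `(0, w)` (the endpoint `t = w` is null)
    refine ((setIntegral_congr_set Ioo_ae_eq_Ioc).symm.trans ?_).trans
      (setIntegral_congr_set Ioo_ae_eq_Ioc)
    refine setIntegral_congr_fun measurableSet_Ioo fun t ht => ?_
    have hprod : (fun v : Fin (d + 1) → ℝ => ∏ i, φ ((Fin.cons t v : Fin (d + 2) → ℝ) i)) =
        fun v => φ t * ∏ i, φ (v i) := by
      funext v
      rw [Fin.prod_univ_succ]
      simp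
    rw [hprod, sliceIntegral_const_mul, sliceIntegral_prod_eq_cpow hφ d (by linarith [ht.2])]

/-- The slice integrand is additive in `G`. [folklore] -/
theorem sliceIntegrand_add (d : ℕ) (w : ℝ) (G G' : (Fin (d + 1) → ℝ) → ℝ) (u : Fin d → ℝ) :
    sliceIntegrand d w (fun v => G v + G' v) u = sliceIntegrand d w G u + sliceIntegrand d w G' u := by
  unfold sliceIntegrand; split_ifs <;> simp

/-- **Additivity of slice integrals** for measurable integrands bounded on the slice. [folklore] -/
theorem sliceIntegral_add (d : ℕ) (w : ℝ) {G G' : (Fin (d + 1) → ℝ) → ℝ}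
    (hG : Measurable G) (hG' : Measurable G') {C : ℝ} (hC : 0 ≤ C)
    (hGb : ∀ v : Fin (d + 1) → ℝ, (∀ i, 0 < v i) → ∑ i, v i = w → |G v| ≤ C)
    (hG'b : ∀ v : Fin (d + 1) → ℝ, (∀ i, 0 < v i) → ∑ i, v i = w → |G' v| ≤ C) :
    sliceIntegral (d + 1) w (fun v => G v + G' v) =
      sliceIntegral (d + 1) w G + sliceIntegral (d + 1) w G' := by
  rw [sliceIntegral_succ_eq, sliceIntegral_succ_eq, sliceIntegral_succ_eq,
    ← integral_add (integrable_sliceIntegrand d w hG hC hGb) (integrable_sliceIntegrand d w hG' hC hG'b)]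
  exact integral_congr_ae (Filter.Eventually.of_forall fun u => sliceIntegrand_add d w G G' u)

/-- A bound on the slice for a product integrand `A ∏ φ(u_i)` with `φ` locally bounded. [folklore] -/
theorem exists_bound_prod {φ : ℝ → ℝ} (hφ : LocBdd φ) (A : ℝ) (d : ℕ) (w : ℝ) :
    ∃ C : ℝ, 0 ≤ C ∧ ∀ v : Fin (d + 1) → ℝ, (∀ i, 0 < v i) → ∑ i, v i = w →
      |A * ∏ i, φ (v i)| ≤ C := by
  obtain ⟨B, hB0, hB⟩ := hφ.bdd_nonneg w
  refine ⟨|A| * B ^ (d + 1), by positivity, fun v hv hsum => ?_⟩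
  rw [abs_mul, Finset.abs_prod]
  refine mul_le_mul_of_nonneg_left ?_ (abs_nonneg _)
  calc ∏ i, |φ (v i)| ≤ ∏ _i : Fin (d + 1), B := by
        refine Finset.prod_le_prod (fun i _ => abs_nonneg _) fun i _ => hB _ ?_
        have : v i ≤ ∑ j, v j := Finset.single_le_sum (f := v) (fun j _ => (hv j).le) (Finset.mem_univ i)
        rw [abs_of_pos (hv i)]; linarith
    _ = B ^ (d + 1) := by simp

/-- Slice integral of `A ∏ φ(u_i)`: `A φ^{⋆(d+1)}(w)`. [folklore] -/
theorem sliceIntegral_const_mul_prod {φ : ℝ → ℝ} (hφ : LocBdd φ) (A : ℝ) (d : ℕ) {w : ℝ} (hw : 0 < w) :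
    sliceIntegral (d + 1) w (fun u => A * ∏ i, φ (u i)) = A * cpow φ (d + 1) w := by
  rw [sliceIntegral_const_mul, sliceIntegral_prod_eq_cpow hφ d hw]

end Slice

end Literature.NumberTheory.Sieve.FordMaynard
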